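import Summits.QuantumAdvantage.QuantumAdvantage.Theorems.SosSandwichPseudoBoundedAABooleanCorner
import HarnessLib

/-!
# Crux `PseudoBoundedAA` (stmt-QuantumAdvantage-15237, route SosSandwich) — the BLOCK-PRODUCT classical corner:
# mixtures of Boolean decision trees on pairwise DISJOINT blocks obey the sharp law `16 · Var[p]² ≤ T · maxⱼ Infⱼ[p]`

Support file for the rank-2 crux PB-AA (`Theses/SosSandwich.lean`, item stmt-QuantumAdvantage-15237).  On the classical
corner `R_T ⊆ K_T` (acceptance probabilities `p = Σ_k w_k·[t_k accepts]` of randomized classical `T`-query algorithms)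
the tree holds the law with `T`-exponent TWO (`ClassicalCorner…`, `16·Var² ≤ D̄²·maxInf`) and with `T`-exponent ONE on
two sub-corners: a single Boolean tree (`BooleanCorner.exists_influence_ge_of_decisionTree`, OSSS) and NONADAPTIVE
mixtures (`ClassicalCornerNonadaptive`, mixtures of `≤ T`-juntas).  Whether exponent one holds on all of `R_T` is the open
calibration question recorded by the previous hands.

This file adds the sub-corner in between: ADAPTIVE inside each component, but the components live on pairwise disjoint
blocks of variables.  If `p = Σ_{k∈s} w_k·[t_k accepts]` (`w_k ≥ 0`, `Σ w_k ≤ 1`) where `t_k` is a Boolean decision tree of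
depth `≤ T` reading only coordinates of a block `S_k`, and the blocks `S_k` (`k ∈ s`) are pairwise disjoint, then

  `16 · Var[p]² ≤ T · maxⱼ Infⱼ[p]`   (`exists_influence_ge_of_blockDisjointTrees`),

the sharp constant (equality shape at `T = 1`: one uniformly random variable, `Var = 1/(4N)`, `Inf = 1/N²`).  A depth-`T`
tree is a `(2^T − 1)`-junta, so the nonadaptive corner only gives `16·Var² ≤ (2^T − 1)·maxInf` here.

Proof.  Write `F_k = [t_k accepts]`, `V_k = Var[F_k] ≤ ¼`.  (i) Disjoint blocks are independent under the uniform
measure (`two_pow_mul_sum_mul_eq_sum_mul_sum`, proved by the measure-preserving involution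
`(x, y) ↦ (x|_S ∪ y|_{Sᶜ}, y|_S ∪ x|_{Sᶜ})` of the squared cube), so `Var[p] = Σ_k w_k² V_k`; (ii) for `j ∈ S_k` only the
`k`-th component sees `j`, so `Infⱼ[p] = w_k² Infⱼ[F_k]`; (iii) OSSS for one Boolean tree (`BooleanCorner.osss_depth`):
`4 V_k ≤ T · maxⱼ Infⱼ[F_k]`.  With `k*` maximizing `w_k V_k`:
`Var[p] = Σ_k w_k (w_k V_k) ≤ w* V*`, hence `16 Var[p]² ≤ 16 w*² V*² ≤ 4 w*² V* ≤ T · w*² maxⱼ Infⱼ[F*] = T · maxⱼ Infⱼ[p]`.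

UPSHOT for the calibration question: a family in `R_T` separating the `T`-exponents `1` and `2` needs components with
OVERLAPPING supports whose discrete derivatives cancel in sign (`Infⱼ[Σ w_k F_k] ≪ Σ w_k² Infⱼ[F_k]`); adaptivity alone
(inside disjoint blocks) does not produce a gap.

Honest label: an elementary consequence of OSSS and independence calibrating a sub-corner of the classical corner of an
open conjecture; no stub, crux or summit is closed.
Sources: R. O'Donnell, M. Saks, O. Schramm, R. Servedio, *Every decision tree has an influential variable*, FOCS 2005,
Thm 1.1; R. O'Donnell, *Analysis of Boolean Functions* (CUP 2014) §8.6; S. Aaronson, A. Ambainis, *The need for structure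
in quantum speedups*, arXiv:0911.0996, Conj. 6 / Thm 8.
-/

set_option linter.dupNamespace false

noncomputable section

namespace Summit.QuantumAdvantage.QuantumAdvantage.Theorems.SosSandwich

open Finset Function
open Literature.Computability.Complexity Literature.Computability.QuantumComplexity

namespace ClassicalCornerBlockProduct

variable {N : ℕ}

/-- **Independence of disjoint blocks on the uniform cube.**  If `f` depends only on the coordinates in `S` and `g` only on
the coordinates outside `S`, then `2^N · Σ_x f(x) g(x) = (Σ_x f(x)) · (Σ_x g(x))`, i.e. `E[fg] = E[f]·E[g]`.  Proof: the map
`(x, y) ↦ (S.piecewise x y, S.piecewise y x)` is an involution of the squared cube carrying `f(x) g(x)` to `f(x) g(y)`.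
[cite: ODonnell2014, §8.6 (product probability spaces)] [folklore] -/
theorem two_pow_mul_sum_mul_eq_sum_mul_sum (S : Finset (Fin N)) (f g : (Fin N → Bool) → ℝ)
    (hf : ∀ x y : Fin N → Bool, (∀ i ∈ S, x i = y i) → f x = f y)
    (hg : ∀ x y : Fin N → Bool, (∀ i, i ∉ S → x i = y i) → g x = g y) :
    (2 : ℝ) ^ N * ∑ x, f x * g x = (∑ x, f x) * (∑ x, g x) := by
  classical
  set σ : (Fin N → Bool) × (Fin N → Bool) → (Fin N → Bool) × (Fin N → Bool) :=
    fun xy => (S.piecewise xy.1 xy.2, S.piecewise xy.2 xy.1) with hσdef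
  have hpw : ∀ x y : Fin N → Bool, S.piecewise (S.piecewise x y) (S.piecewise y x) = x := by
    intro x y
    funext i
    by_cases hi : i ∈ S
    · rw [Finset.piecewise_eq_of_mem _ _ _ hi, Finset.piecewise_eq_of_mem _ _ _ hi]
    · rw [Finset.piecewise_eq_of_notMem _ _ _ hi, Finset.piecewise_eq_of_notMem _ _ _ hi]
  have hσ : Function.Involutive σ := by
    rintro ⟨x, y⟩
    simp only [hσdef, hpw]
  have h1 : ∀ x y : Fin N → Bool, f (S.piecewise x y) = f x := fun x y =>
    hf _ _ fun i hi => Finset.piecewise_eq_of_mem _ _ _ hi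
  have h2 : ∀ x y : Fin N → Bool, g (S.piecewise x y) = g y := fun x y =>
    hg _ _ fun i hi => Finset.piecewise_eq_of_notMem _ _ _ hi
  have key : ∑ xy : (Fin N → Bool) × (Fin N → Bool), f xy.1 * g xy.2
      = ∑ xy : (Fin N → Bool) × (Fin N → Bool), f xy.1 * g xy.1 := by
    have h := hσ.bijective.sum_comp (fun z : (Fin N → Bool) × (Fin N → Bool) => f z.1 * g z.1)
    simp only [hσdef, h1, h2] at h
    exact h
  have hL : ∑ xy : (Fin N → Bool) × (Fin N → Bool), f xy.1 * g xy.2 = (∑ x, f x) * (∑ x, g x) := by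
    rw [Fintype.sum_prod_type, Finset.sum_mul_sum]
  have hR : ∑ xy : (Fin N → Bool) × (Fin N → Bool), f xy.1 * g xy.1 = (2 : ℝ) ^ N * ∑ x, f x * g x := by
    rw [Fintype.sum_prod_type, Finset.mul_sum]
    refine Finset.sum_congr rfl fun x _ => ?_
    dsimp only
    rw [Finset.sum_const, Finset.card_univ, BooleanCorner.card_cube_nat, nsmul_eq_mul]
    push_cast
    ring
  rw [← hR, ← key, hL]

/-- **The block-product classical corner obeys `16 · Var[p]² ≤ T · maxⱼ Infⱼ[p]` (sharp constant).**  Let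
`p = Σ_{k∈s} w_k·[t_k accepts]` on the cube with `w_k ≥ 0`, `Σ w_k ≤ 1`, each `t_k` a Boolean decision tree of depth
`≤ T` whose output depends only on the coordinates of a block `S_k`, the blocks being pairwise disjoint.  If `Var[p] > 0`
then some variable `j` has `16 · Var[p]² ≤ T · Infⱼ[p]` — exponent ONE in `T` although every component may be adaptive.
Ingredients: independence of disjoint blocks (`Var[p] = Σ w_k² Var[F_k]`), `Infⱼ[p] = w_k² Infⱼ[F_k]` for `j ∈ S_k`, and
OSSS for one Boolean tree (`BooleanCorner.osss_depth`: `4·Var[F_k] ≤ T·maxⱼ Infⱼ[F_k]`).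
[cite: OdonnellEtAl2005, Thm 1.1] [cite: ODonnell2014, §8.6] [cite: AaronsonAmbainis2014, Conj. 6 / Thm 8] -/
theorem exists_influence_ge_of_blockDisjointTrees {ι : Type*} (s : Finset ι) (w : ι → ℝ)
    (hw : ∀ k ∈ s, 0 ≤ w k) (hw1 : ∑ k ∈ s, w k ≤ 1)
    (S : ι → Finset (Fin N)) (hdisj : ∀ k ∈ s, ∀ l ∈ s, k ≠ l → Disjoint (S k) (S l))
    (T : ℕ) (t : ι → DecisionTree N) (hdepth : ∀ k ∈ s, (t k).depth ≤ T)
    (ht : ∀ k ∈ s, ∀ x y : Fin N → Bool, (∀ i ∈ S k, x i = y i) → (t k).eval x = (t k).eval y)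
    (p : MvPolynomial (Fin N) ℝ)
    (hp : ∀ x, evalBool p x = ∑ k ∈ s, w k * (if (t k).eval x = true then (1 : ℝ) else 0))
    (hv : 0 < boolVariance p) :
    ∃ j : Fin N, 16 * boolVariance p ^ 2 ≤ (T : ℝ) * influence j p := by
  classical
  rcases Nat.eq_zero_or_pos N with hN0 | hNpos
  · subst hN0
    exact absurd (BooleanCorner.boolVariance_fin_zero p) (ne_of_gt hv)
  -- notation
  set E : ℝ := (2 : ℝ) ^ N with hE
  have hEpos : 0 < E := by positivity
  set F : ι → (Fin N → Bool) → ℝ := fun k x => if (t k).eval x = true then (1 : ℝ) else 0 with hFdef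
  have hF01 : ∀ k x, F k x = 0 ∨ F k x = 1 := by
    intro k x
    simp only [hFdef]
    split_ifs <;> simp
  have hFsq : ∀ k x, F k x * F k x = F k x := by
    intro k x
    rcases hF01 k x with h | h <;> simp [h]
  have hFdep : ∀ k ∈ s, ∀ x y : Fin N → Bool, (∀ i ∈ S k, x i = y i) → F k x = F k y := by
    intro k hk x y hxy
    simp only [hFdef, ht k hk x y hxy]
  set A : ι → ℝ := fun k => ∑ x, F k x with hAdef
  set V : ι → ℝ := fun k => E * (∑ x, F k x * F k x) - A k * A k with hVdef
  set I : ι → Fin N → ℝ := fun k j => ∑ x, |F k (update x j true) - F k (update x j false)| with hIdef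
  have hA0 : ∀ k, 0 ≤ A k := fun k =>
    Finset.sum_nonneg fun x _ => by rcases hF01 k x with h | h <;> simp [h]
  have hAE : ∀ k, A k ≤ E := by
    intro k
    calc A k = ∑ x, F k x := rfl
      _ ≤ ∑ _x : Fin N → Bool, (1 : ℝ) :=
          Finset.sum_le_sum fun x _ => by rcases hF01 k x with h | h <;> simp [h]
      _ = E := by
          rw [Finset.sum_const, Finset.card_univ, BooleanCorner.card_cube_nat, nsmul_eq_mul, mul_one]
          push_cast
          rfl
  have hVeq : ∀ k, V k = A k * (E - A k) := by
    intro k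
    simp only [hVdef, hAdef]
    rw [Finset.sum_congr rfl fun x _ => hFsq k x]
    ring
  have hV0 : ∀ k, 0 ≤ V k := fun k => by
    rw [hVeq]
    exact mul_nonneg (hA0 k) (sub_nonneg.2 (hAE k))
  have hVle : ∀ k, V k ≤ E ^ 2 / 4 := by
    intro k
    rw [hVeq]
    nlinarith [hA0 k, hAE k, sq_nonneg (E - 2 * A k)]
  have hI0 : ∀ k j, 0 ≤ I k j := fun k j => Finset.sum_nonneg fun x _ => abs_nonneg _
  -- (1) independence of disjoint blocks: the cross terms vanish
  have hcross : ∀ k ∈ s, ∀ l ∈ s, k ≠ l → E * ∑ x, F k x * F l x = A k * A l := by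
    intro k hk l hl hkl
    refine two_pow_mul_sum_mul_eq_sum_mul_sum (S k) (F k) (F l) (hFdep k hk) ?_
    intro x y hxy
    refine hFdep l hl x y fun i hi => hxy i fun hik => ?_
    exact Finset.disjoint_left.1 (hdisj k hk l hl hkl) hik hi
  -- (2) the variance identity `E · (E · Var[p]) = Σ_k w_k² V_k`
  have hvar : E * (E * boolVariance p) = ∑ k ∈ s, w k ^ 2 * V k := by
    rw [← BooleanCorner.sum_sq_sub_sq_sum_eq p]
    have hsq : ∑ x, evalBool p x * evalBool p x
        = ∑ k ∈ s, ∑ l ∈ s, w k * w l * ∑ x, F k x * F l x := by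
      calc ∑ x, evalBool p x * evalBool p x
          = ∑ x, ∑ k ∈ s, ∑ l ∈ s, w k * w l * (F k x * F l x) := by
            refine Finset.sum_congr rfl fun x _ => ?_
            rw [hp x, Finset.sum_mul_sum]
            exact Finset.sum_congr rfl fun k _ => Finset.sum_congr rfl fun l _ => by ring
        _ = ∑ k ∈ s, ∑ x, ∑ l ∈ s, w k * w l * (F k x * F l x) := Finset.sum_comm
        _ = ∑ k ∈ s, ∑ l ∈ s, ∑ x, w k * w l * (F k x * F l x) :=
            Finset.sum_congr rfl fun k _ => Finset.sum_comm
        _ = ∑ k ∈ s, ∑ l ∈ s, w k * w l * ∑ x, F k x * F l x :=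
            Finset.sum_congr rfl fun k _ => Finset.sum_congr rfl fun l _ => by rw [Finset.mul_sum]
    have hlin : ∑ x, evalBool p x = ∑ k ∈ s, w k * A k := by
      calc ∑ x, evalBool p x = ∑ x, ∑ k ∈ s, w k * F k x := Finset.sum_congr rfl fun x _ => hp x
        _ = ∑ k ∈ s, ∑ x, w k * F k x := Finset.sum_comm
        _ = ∑ k ∈ s, w k * A k := Finset.sum_congr rfl fun k _ => by rw [Finset.mul_sum]
    rw [hsq, hlin, Finset.sum_mul_sum, Finset.mul_sum, ← Finset.sum_sub_distrib]
    refine Finset.sum_congr rfl fun k hk => ?_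
    rw [Finset.mul_sum, ← Finset.sum_sub_distrib]
    rw [Finset.sum_eq_single_of_mem k hk]
    · simp only [hVdef]
      ring
    · intro l hl hlk
      have hc := hcross k hk l hl (Ne.symm hlk)
      calc E * (w k * w l * ∑ x, F k x * F l x) - w k * A k * (w l * A l)
          = w k * w l * (E * ∑ x, F k x * F l x - A k * A l) := by ring
        _ = 0 := by rw [hc, sub_self, mul_zero]
  -- (3) the component `k*` maximizing `w_k V_k`
  have hs : s.Nonempty := by
    rw [Finset.nonempty_iff_ne_empty]
    rintro rfl
    have h0 : E * (E * boolVariance p) = 0 := by rw [hvar, Finset.sum_empty]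
    have : boolVariance p = 0 := by
      rcases mul_eq_zero.1 h0 with h | h
      · exact absurd h hEpos.ne'
      · rcases mul_eq_zero.1 h with h' | h'
        · exact absurd h' hEpos.ne'
        · exact h'
    exact absurd this (ne_of_gt hv)
  obtain ⟨ks, hks, hkmax⟩ := Finset.exists_max_image s (fun k => w k * V k) hs
  have hwV0 : 0 ≤ w ks * V ks := mul_nonneg (hw ks hks) (hV0 ks)
  have hX_le : E * (E * boolVariance p) ≤ w ks * V ks := by
    rw [hvar]
    calc ∑ k ∈ s, w k ^ 2 * V k = ∑ k ∈ s, w k * (w k * V k) :=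
          Finset.sum_congr rfl fun k _ => by ring
      _ ≤ ∑ k ∈ s, w k * (w ks * V ks) :=
          Finset.sum_le_sum fun k hk => mul_le_mul_of_nonneg_left (hkmax k hk) (hw k hk)
      _ = (∑ k ∈ s, w k) * (w ks * V ks) := by rw [Finset.sum_mul]
      _ ≤ 1 * (w ks * V ks) := mul_le_mul_of_nonneg_right hw1 hwV0
      _ = w ks * V ks := one_mul _
  -- (4) the variable `j*` maximizing the `L¹` increments of `F_{k*}`, and OSSS for the tree `t_{k*}`
  have hne : (Finset.univ : Finset (Fin N)).Nonempty := ⟨⟨0, hNpos⟩, Finset.mem_univ _⟩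
  obtain ⟨js, -, hjmax⟩ := Finset.exists_max_image Finset.univ (fun j => I ks j) hne
  have hosss : V ks ≤ (T : ℝ) * E * I ks js / 4 := by
    have key := BooleanCorner.osss_depth (t ks) (F ks) (F ks) (I ks js) (fun x => rfl) (hI0 ks js)
      (fun j => hjmax j (Finset.mem_univ _))
    have hd : ((t ks).depth : ℝ) ≤ T := by exact_mod_cast hdepth ks hks
    calc V ks = (2 : ℝ) ^ N * (∑ x, F ks x * F ks x) - (∑ x, F ks x) * (∑ x, F ks x) := rfl
      _ ≤ ((t ks).depth : ℝ) * (2 : ℝ) ^ N * I ks js / 4 := key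
      _ ≤ (T : ℝ) * (2 : ℝ) ^ N * I ks js / 4 := by
          have : 0 ≤ (2 : ℝ) ^ N * I ks js / 4 := by positivity
          nlinarith
      _ = (T : ℝ) * E * I ks js / 4 := by rw [hE]
  -- (5) `I_{k*}(j*) > 0`, hence `j* ∈ S_{k*}`
  have hIpos : 0 < I ks js := by
    rcases (hI0 ks js).lt_or_eq with h | h
    · exact h
    · exfalso
      have hV : V ks = 0 := le_antisymm (by rw [← h, mul_zero, zero_div] at hosss; exact hosss) (hV0 ks)
      have h0 : E * (E * boolVariance p) ≤ 0 := by rw [hV, mul_zero] at hX_le; exact hX_le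
      have h1 : 0 ≤ E * (E * boolVariance p) := by positivity
      have : boolVariance p = 0 := by
        have h2 : E * (E * boolVariance p) = 0 := le_antisymm h0 h1
        rcases mul_eq_zero.1 h2 with h | h
        · exact absurd h hEpos.ne'
        · rcases mul_eq_zero.1 h with h' | h'
          · exact absurd h' hEpos.ne'
          · exact h'
      exact absurd this (ne_of_gt hv)
  have hjs : js ∈ S ks := by
    by_contra hjs
    have : I ks js = 0 := by
      refine Finset.sum_eq_zero fun x _ => ?_
      rw [hFdep ks hks (update x js true) (update x js false) fun i hi => ?_, sub_self, abs_zero]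
      have hij : i ≠ js := fun h => hjs (h ▸ hi)
      rw [update_of_ne hij, update_of_ne hij]
    exact absurd this (ne_of_gt hIpos)
  -- (6) `E · Inf_{j*}[p] = w_{k*}² · I_{k*}(j*)`: only the `k*`-th component sees `j*`
  have hinf : E * influence js p = w ks ^ 2 * I ks js := by
    rw [← BooleanCorner.sum_sq_update_eq_influence p js]
    have hpt : ∀ x : Fin N → Bool, evalBool p (update x js true) - evalBool p (update x js false)
        = w ks * (F ks (update x js true) - F ks (update x js false)) := by
      intro x
      rw [hp, hp, ← Finset.sum_sub_distrib]
      rw [Finset.sum_eq_single_of_mem ks hks]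
      · ring
      · intro l hl hlk
        have hjl : js ∉ S l := fun h =>
          Finset.disjoint_left.1 (hdisj ks hks l hl (Ne.symm hlk)) hjs h
        show w l * F l (update x js true) - w l * F l (update x js false) = 0
        rw [hFdep l hl (update x js true) (update x js false) fun i hi => ?_, sub_self]
        have hij : i ≠ js := fun h => hjl (h ▸ hi)
        rw [update_of_ne hij, update_of_ne hij]
    have habs : ∀ x : Fin N → Bool, (F ks (update x js true) - F ks (update x js false)) ^ 2
        = |F ks (update x js true) - F ks (update x js false)| := by
      intro x
      rcases hF01 ks (update x js true) with h | h <;>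
        rcases hF01 ks (update x js false) with h' | h' <;> simp [h, h']
    simp only [hIdef]
    rw [Finset.mul_sum]
    refine Finset.sum_congr rfl fun x _ => ?_
    rw [hpt x, mul_pow, habs x]
  -- (7) assemble: `16 (E² Var)² ≤ 16 (w* V*)² ≤ 4 E² w*² V* ≤ T E³ w*² I* = T E⁴ Inf_{j*}`
  refine ⟨js, ?_⟩
  have hX0 : 0 ≤ E * (E * boolVariance p) := by positivity
  have hw0 : 0 ≤ w ks := hw ks hks
  have h1 : 16 * (E * (E * boolVariance p)) ^ 2 ≤ 16 * (w ks * V ks) ^ 2 :=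
    mul_le_mul_of_nonneg_left (pow_le_pow_left₀ hX0 hX_le 2) (by norm_num)
  have h2 : 16 * (w ks * V ks) ^ 2 ≤ 4 * E ^ 2 * (w ks ^ 2 * V ks) := by
    have := hVle ks
    have hV := hV0 ks
    nlinarith [sq_nonneg (w ks), mul_nonneg (sq_nonneg (w ks)) hV]
  have h3 : 4 * E ^ 2 * (w ks ^ 2 * V ks) ≤ (T : ℝ) * E ^ 3 * (w ks ^ 2 * I ks js) := by
    have hw2 : 0 ≤ E ^ 2 * w ks ^ 2 := by positivity
    have := mul_le_mul_of_nonneg_left hosss hw2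
    nlinarith [this]
  have h4 : (T : ℝ) * E ^ 3 * (w ks ^ 2 * I ks js) = E ^ 4 * ((T : ℝ) * influence js p) := by
    rw [← hinf]
    ring
  have hmain : E ^ 4 * (16 * boolVariance p ^ 2) ≤ E ^ 4 * ((T : ℝ) * influence js p) := by
    calc E ^ 4 * (16 * boolVariance p ^ 2) = 16 * (E * (E * boolVariance p)) ^ 2 := by ring
      _ ≤ _ := h1
      _ ≤ _ := h2
      _ ≤ _ := h3
      _ = _ := h4
  exact le_of_mul_le_mul_left hmain (by positivity)

end ClassicalCornerBlockProduct

end Summit.QuantumAdvantage.QuantumAdvantage.Theorems.SosSandwich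

end
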